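import Summits.ValiantsHypothesis.ValiantsHypothesis.Theorems.DivisionGapPerDivisionHardPerPowers

/-!
# Crux `DivisionGap.PerDivisionHard` (stmt-ValiantsHypothesis-5065), line `pair-descent-jss-endpoint` —
stub `stub_purePair`: margins and pure monomials through multiplication by `per_n`

Over the semiring `ℝ≥0` nothing cancels: `supp (per_n · h) ⊆ supp per_n + supp h`
(`MvPolynomial.support_mul`) and conversely `a ∈ supp p`, `b ∈ supp q` give `a + b ∈ supp (p · q)`
(`Literature.Barriers.ValiantsHypothesis.add_mem_support_mul`).  The monomials of `per_n` are the
permutation monomials `μ_σ = ∑ i, e_{(σ i, i)}`, with unit row and column sums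
(`rowCount_permMonomial`, `colCount_permMonomial`).  Hence, for a cofactor `h` all of whose
monomials have row sums `R` and column sums `Cc`:

* `margins_perPoly_mul` — every monomial of `per_n · h` has row sums `R + 1` and column sums
  `Cc + 1` (the `succ` step of `margins_perPow`);
* `pure_mem_support_perPoly_mul` — the pure monomial `∑ j, R (π j) • e_{(π j, j)}` of type `R` on
  `π` in `supp h` is carried to the pure monomial `∑ j, (R (π j) + 1) • e_{(π j, j)} = μ_π + ⋯` of
  type `R + 1` on `π` in `supp (per_n · h)` (cf. `smul_permMonomial_mem_support_perPow`);
* `stub_purePair` — the registered conjunction of the two, feeding the pure-rich rung (the typed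
  vertex count applied to `per_n · h`).
-/

noncomputable section

-- `Summit.ValiantsHypothesis.ValiantsHypothesis.…` is the tree's mandated single-conjunct layout
-- (Sub = Summit), so the duplicated namespace component is intended.
set_option linter.dupNamespace false

namespace Summit.ValiantsHypothesis.ValiantsHypothesis.Theorems.DivisionGapPerDivisionHard

open MvPolynomial Literature.Computability.AlgebraicComplexity
open scoped NNReal

variable {n : ℕ}

/-! ### Margins through multiplication by the permanent -/

/-- If every monomial of `h` has row sums `R` and column sums `Cc`, then every monomial of
`per_n · h` has row sums `R + 1` and column sums `Cc + 1`: it is `μ_σ + β` with `μ_σ` a permutation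
monomial (one cell in each row and each column) and `β ∈ supp h`
(`supp (per · h) ⊆ supp per + supp h`). [folklore] -/
theorem margins_perPoly_mul (h : MvPolynomial (Fin n × Fin n) ℝ≥0) (R Cc : Fin n → ℕ)
    (hh : ∀ α ∈ h.support, (∀ i, ∑ j, α (i, j) = R i) ∧ (∀ j, ∑ i, α (i, j) = Cc j)) :
    ∀ α ∈ (perPoly (Fin n) ℝ≥0 * h).support,
      (∀ i, ∑ j, α (i, j) = R i + 1) ∧ (∀ j, ∑ i, α (i, j) = Cc j + 1) := by
  classical
  intro α hα
  obtain ⟨u, hu, β, hβ, rfl⟩ := Finset.mem_add.mp (support_mul _ _ hα)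
  obtain ⟨σ, rfl⟩ := exists_permMonomial_eq_of_coeff_perPoly_ne_zero ℝ≥0 (mem_support_iff.mp hu)
  obtain ⟨hr, hc⟩ := hh β hβ
  refine ⟨fun i => ?_, fun j => ?_⟩
  · have h1 : ∑ j, permMonomial σ (i, j) = 1 := rowCount_permMonomial σ i
    simp only [Finsupp.coe_add, Pi.add_apply, Finset.sum_add_distrib, h1, hr i]
    omega
  · have h1 : ∑ i, permMonomial σ (i, j) = 1 := colCount_permMonomial σ j
    simp only [Finsupp.coe_add, Pi.add_apply, Finset.sum_add_distrib, h1, hc j]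
    omega

/-! ### Pure monomials through multiplication by the permanent -/

/-- The pure monomial of type `R + 1` on `π` is `μ_π` plus the pure monomial of type `R` on `π`:
`∑ j, (R (π j) + 1) • e_{(π j, j)} = μ_π + ∑ j, R (π j) • e_{(π j, j)}`. [folklore] -/
theorem sum_single_succ_eq_permMonomial_add (R : Fin n → ℕ) (π : Equiv.Perm (Fin n)) :
    (∑ j, Finsupp.single (π j, j) (R (π j) + 1)) =
      permMonomial π + ∑ j, Finsupp.single (π j, j) (R (π j)) := by
  simp only [Finsupp.single_add, Finset.sum_add_distrib, permMonomial]
  exact add_comm _ _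

/-- If the pure monomial `∑ j, R (π j) • e_{(π j, j)}` of type `R` on `π` occurs in `h`, then the
pure monomial `∑ j, (R (π j) + 1) • e_{(π j, j)} = μ_π + ⋯` of type `R + 1` on `π` occurs in
`per_n · h`: over `ℝ≥0` nothing cancels (`add_mem_support_mul`) and `μ_π ∈ supp per_n`
(`coeff_permMonomial_perPoly`). [folklore] -/
theorem pure_mem_support_perPoly_mul (h : MvPolynomial (Fin n × Fin n) ℝ≥0) (R : Fin n → ℕ)
    (π : Equiv.Perm (Fin n)) (hπ : (∑ j, Finsupp.single (π j, j) (R (π j))) ∈ h.support) :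
    (∑ j, Finsupp.single (π j, j) (R (π j) + 1)) ∈ (perPoly (Fin n) ℝ≥0 * h).support := by
  classical
  rw [sum_single_succ_eq_permMonomial_add]
  refine Literature.Barriers.ValiantsHypothesis.add_mem_support_mul ?_ hπ
  rw [mem_support_iff, coeff_permMonomial_perPoly]
  exact one_ne_zero

/-! ### The stub -/

/-- **Stub `stub_purePair`** (line `pair-descent-jss-endpoint`). Multiplication by `per_n` over
`ℝ≥0` shifts margins by one (`margins_perPoly_mul`: `supp (per · h) ⊆ supp per + supp h`,
permutation monomials have unit margins) and carries the pure monomial of type `R` on `π` in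
`supp h` to the pure monomial of type `R + 1` on `π` in `supp (per_n · h)`
(`pure_mem_support_perPoly_mul`: add `μ_π`; nothing cancels). [folklore] -/
theorem stub_purePair :
    ∀ (n : ℕ) (h : MvPolynomial (Fin n × Fin n) ℝ≥0) (R Cc : Fin n → ℕ),
      (∀ α ∈ h.support, (∀ i, ∑ j, α (i, j) = R i) ∧ (∀ j, ∑ i, α (i, j) = Cc j)) →
      (∀ α ∈ (perPoly (Fin n) ℝ≥0 * h).support,
          (∀ i, ∑ j, α (i, j) = R i + 1) ∧ (∀ j, ∑ i, α (i, j) = Cc j + 1)) ∧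
      ∀ π : Equiv.Perm (Fin n), (∑ j, Finsupp.single (π j, j) (R (π j))) ∈ h.support →
        (∑ j, Finsupp.single (π j, j) (R (π j) + 1)) ∈ (perPoly (Fin n) ℝ≥0 * h).support :=
  fun _ h R Cc hh => ⟨margins_perPoly_mul h R Cc hh, fun π => pure_mem_support_perPoly_mul h R π⟩

end Summit.ValiantsHypothesis.ValiantsHypothesis.Theorems.DivisionGapPerDivisionHard

end
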